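/-
HONEST FRAMING: certified error envelopes and provably optimal rounding/accumulation schemes for
low-precision formats under stated cost models; every table by two implementations; no hardware
or vendor claims.
-/
import Summits.Ventures.CertifiedArithmetic.LowPrec.OptDemotion

/-!
# The demotion law (Theorem T8), part 5e′: grid facts of `F(q, emin)` for the node step

Small facts about the floating-point grid used by the line-family proof of Conjecture D
(`OptDemotionNodeWrap`, `OptDemotionEveryTree`): a float `≥ 2^K` is an integer multiple of
`2^(K+1-q)`; a positive float below `2^J` is at most `2^J - 2^(J-q)`; comparison of grid points;
`Int.log` from a binade sandwich; `u·2^K = 2^(K-q)`; and the half-ulp facts for a rounded sum of two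
nonnegative floats (`round_sum_facts`).
-/

namespace Summit.Ventures.CertifiedArithmetic.LowPrec.Opt

open Literature.ComputerArithmetic.JeannerodRump2018

/-! ## Grid facts -/

/-- A float of `F(q, emin)` that is `≥ 2^K` is an integer multiple of `2^(K+1-q)`. -/
theorem isFloat_grid {q : ℕ} {emin : ℤ} {f : ℚ} (hf : IsFloat q emin f) {K : ℤ}
    (hK : (2 : ℚ) ^ K ≤ f) : ∃ N : ℤ, f = (N : ℚ) * (2 : ℚ) ^ (K + 1 - q) := by
  obtain ⟨M, e, hM, _he, rfl⟩ := hf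
  have h2 : (2 : ℚ) ≠ 0 := by norm_num
  have h2e : (0 : ℚ) < (2 : ℚ) ^ e := zpow_pos (by norm_num) _
  rcases le_or_gt (K + 1 - q) e with hle | hgt
  · obtain ⟨d, hd⟩ : ∃ d : ℕ, e = (K + 1 - q) + d := ⟨(e - (K + 1 - q)).toNat, by omega⟩
    refine ⟨M * 2 ^ d, ?_⟩
    rw [hd, zpow_add₀ h2, zpow_natCast]; push_cast; ring
  · exfalso
    have hMq : (M : ℚ) < 2 ^ q := by
      have h1 := lt_of_le_of_lt (le_abs_self M) hM; exact_mod_cast h1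
    have h1 : (M : ℚ) * 2 ^ e < 2 ^ q * 2 ^ e := mul_lt_mul_of_pos_right hMq h2e
    have h3 : (2 : ℚ) ^ q * 2 ^ e = (2 : ℚ) ^ ((q : ℤ) + e) := by rw [zpow_add₀ h2, zpow_natCast]
    have h4 : (2 : ℚ) ^ ((q : ℤ) + e) ≤ 2 ^ K := zpow_le_zpow_right₀ (by norm_num) (by omega)
    linarith

/-- A positive float of `F(q, emin)` below `2^J` is at most `2^J - 2^(J-q)` (top of the grid). -/
theorem isFloat_le_top {q : ℕ} {emin : ℤ} {f : ℚ} (hf : IsFloat q emin f) (hpos : 0 < f) {J : ℤ}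
    (hlt : f < (2 : ℚ) ^ J) : f ≤ (2 : ℚ) ^ J - (2 : ℚ) ^ (J - q) := by
  have h2 : (2 : ℚ) ≠ 0 := by norm_num
  set k := Int.log 2 f with hk
  have hlow : ((2 : ℕ) : ℚ) ^ k ≤ f := Int.zpow_log_le_self (by norm_num) hpos
  have hup : f < ((2 : ℕ) : ℚ) ^ (k + 1) := Int.lt_zpow_succ_log_self (by norm_num) f
  push_cast at hlow hup
  obtain ⟨N, hN⟩ := isFloat_grid hf hlow
  have hg : (0 : ℚ) < (2 : ℚ) ^ (k + 1 - q) := zpow_pos (by norm_num) _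
  have hk1 : (2 : ℚ) ^ (k + 1) = (2 : ℚ) ^ (q : ℤ) * 2 ^ (k + 1 - q) := by
    rw [← zpow_add₀ h2]; congr 1; ring
  -- N < 2^q hence N ≤ 2^q - 1
  have hNlt : (N : ℚ) < 2 ^ q := by
    have : (N : ℚ) * 2 ^ (k + 1 - q) < (2 : ℚ) ^ (q : ℤ) * 2 ^ (k + 1 - q) := by rw [← hN, ← hk1]; exact hup
    rw [zpow_natCast] at this
    exact lt_of_mul_lt_mul_right this hg.le
  have hNle : (N : ℚ) ≤ 2 ^ q - 1 := by
    have h1 : N < 2 ^ q := by exact_mod_cast hNlt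
    have h2' : N ≤ 2 ^ q - 1 := by omega
    exact_mod_cast h2'
  -- k + 1 ≤ J
  have hkJ : k + 1 ≤ J := by
    by_contra hc
    have : (2 : ℚ) ^ J ≤ 2 ^ k := zpow_le_zpow_right₀ (by norm_num) (by omega)
    linarith
  have hmono : (2 : ℚ) ^ (k + 1) - 2 ^ (k + 1 - q) ≤ 2 ^ J - 2 ^ (J - q) := by
    -- both sides are (1 - 2^-q) times a power of two
    obtain ⟨d, hd⟩ : ∃ d : ℕ, J = (k + 1) + d := ⟨(J - (k + 1)).toNat, by omega⟩
    have e1 : (2 : ℚ) ^ J = 2 ^ (k + 1) * 2 ^ d := by rw [hd, zpow_add₀ h2, zpow_natCast]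
    have e2 : (2 : ℚ) ^ (J - q) = 2 ^ (k + 1 - q) * 2 ^ d := by
      rw [hd, show k + 1 + (d : ℤ) - q = (k + 1 - q) + d by ring, zpow_add₀ h2, zpow_natCast]
    rw [e1, e2]
    have hd1 : (1 : ℚ) ≤ 2 ^ d := one_le_pow₀ (by norm_num)
    have hsub : (0 : ℚ) ≤ 2 ^ (k + 1) - 2 ^ (k + 1 - q) := by
      rw [hk1, zpow_natCast]
      have : (1 : ℚ) ≤ 2 ^ q := one_le_pow₀ (by norm_num)
      nlinarith
    nlinarith
  calc f = (N : ℚ) * 2 ^ (k + 1 - q) := hN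
    _ ≤ (2 ^ q - 1) * 2 ^ (k + 1 - q) := mul_le_mul_of_nonneg_right hNle hg.le
    _ = 2 ^ (k + 1) - 2 ^ (k + 1 - q) := by rw [hk1, zpow_natCast]; ring
    _ ≤ 2 ^ J - 2 ^ (J - q) := hmono

/-- Grid comparison: integer multiples `a < b + g` of `g` satisfy `a ≤ b`. -/
theorem grid_le_of_lt {a b g : ℚ} {A B : ℤ} (hg : 0 < g) (ha : a = (A : ℚ) * g) (hb : b = (B : ℚ) * g)
    (h : a < b + g) : a ≤ b := by
  rw [ha, hb] at h ⊢
  have h1 : (A : ℚ) * g < (B + 1) * g := by linarith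
  have h2 : (A : ℚ) < B + 1 := lt_of_mul_lt_mul_right h1 hg.le
  have h3 : A < B + 1 := by exact_mod_cast h2
  have h4 : (A : ℚ) ≤ B := by exact_mod_cast (Int.lt_add_one_iff.mp h3)
  exact mul_le_mul_of_nonneg_right h4 hg.le

/-- `Int.log` from a binade sandwich. -/
theorem int_log_eq_of_mem {w : ℚ} (hw : 0 < w) {K : ℤ} (hlo : (2 : ℚ) ^ K ≤ w)
    (hhi : w < (2 : ℚ) ^ (K + 1)) : Int.log 2 w = K := by
  have h1 := (Int.zpow_le_iff_le_log (b := 2) (by norm_num) hw).mp (by exact_mod_cast hlo)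
  have h2 := (Int.lt_zpow_iff_log_lt (b := 2) (by norm_num) hw).mp (by exact_mod_cast hhi)
  omega

/-- `u·2^K = 2^(K-q)` and `2u·2^K = 2^(K+1-q)`. -/
theorem u_mul_zpow (q : ℕ) (K : ℤ) :
    unitRoundoff q * (2 : ℚ) ^ K = (2 : ℚ) ^ (K - q) ∧
    2 * unitRoundoff q * (2 : ℚ) ^ K = (2 : ℚ) ^ (K + 1 - q) := by
  have h2 : (2 : ℚ) ≠ 0 := by norm_num
  constructor
  · rw [PTree.two_zpow_sub_prec q K, mul_comm]
  · rw [show K + 1 - (q : ℤ) = (K + 1) - q by ring, PTree.two_zpow_sub_prec q (K + 1),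
      zpow_add_one₀ h2]; ring

/-! ## The rounded sum -/

/-- HALF-ULP FACTS FOR A ROUNDED SUM OF NONNEGATIVE FLOATS: if `v = fl(v_a + v_b) < 2^(K+1)` then
`|v_a + v_b - v| ≤ u·2^K`, and if moreover `v_a + v_b < 2^K` then `v - (v_a+v_b) ≤ u·2^K/2`. -/
theorem round_sum_facts {q : ℕ} (hq : 1 ≤ q) {emin : ℤ} {fl : ℚ → ℚ} (hfl : IsRoundNearest q emin fl)
    {va vb : ℚ} (ha : IsFloat q emin va) (hb : IsFloat q emin vb) (ha0 : 0 ≤ va) (hb0 : 0 ≤ vb)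
    {K : ℤ} (hhi : fl (va + vb) < (2 : ℚ) ^ (K + 1)) :
    |va + vb - fl (va + vb)| ≤ unitRoundoff q * (2 : ℚ) ^ K ∧
    (va + vb < (2 : ℚ) ^ K → fl (va + vb) - (va + vb) ≤ unitRoundoff q * (2 : ℚ) ^ K / 2) := by
  set t := va + vb with ht
  have hu0 := unitRoundoff_nonneg q
  have h2K : (0 : ℚ) < (2 : ℚ) ^ K := zpow_pos (by norm_num) _
  by_cases hsmall : |t| < (2 : ℚ) ^ (emin + q)
  · have hex : fl t = t := fl_eq_self hfl (isFloat_add_of_small ha hb hsmall)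
    rw [hex, sub_self, abs_zero]
    exact ⟨by positivity, fun _ => by positivity⟩
  · have ht0 : 0 ≤ t := add_nonneg ha0 hb0
    rw [abs_of_nonneg ht0, not_lt] at hsmall
    have htpos : 0 < t := lt_of_lt_of_le (zpow_pos (by norm_num) _) hsmall
    set k := Int.log 2 t with hk
    have hlow : ((2 : ℕ) : ℚ) ^ k ≤ t := Int.zpow_log_le_self (by norm_num) htpos
    have hup : t < ((2 : ℕ) : ℚ) ^ (k + 1) := Int.lt_zpow_succ_log_self (by norm_num) t
    push_cast at hlow hup
    have hke : emin + q ≤ k + 1 := by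
      by_contra hc
      have : (2 : ℚ) ^ (k + 1) ≤ 2 ^ (emin + (q : ℤ)) := zpow_le_zpow_right₀ (by norm_num) (by omega)
      linarith
    have herr := abs_sub_fl_le_half_ulp hq hfl hlow hup hke
    -- 2^k is a float below t, hence below fl t < 2^(K+1): k ≤ K
    have hkK : k ≤ K := by
      have hf2 : IsFloat q emin ((2 : ℚ) ^ k) := PTree.isFloat_two_zpow hq (by omega)
      have h1 : (2 : ℚ) ^ k ≤ fl t := le_fl_of_isFloat_le hfl hf2 hlow
      by_contra hc
      have : (2 : ℚ) ^ (K + 1) ≤ 2 ^ k := zpow_le_zpow_right₀ (by norm_num) (by omega)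
      linarith
    have hpow : (2 : ℚ) ^ k ≤ 2 ^ K := zpow_le_zpow_right₀ (by norm_num) hkK
    refine ⟨?_, fun hlt => ?_⟩
    · exact herr.trans (mul_le_mul_of_nonneg_left hpow hu0)
    · have hkK' : k + 1 ≤ K := by
        by_contra hc
        have hkk : k = K := by omega
        rw [hkk] at hlow; linarith
      have hpow' : (2 : ℚ) ^ k ≤ 2 ^ K / 2 := by
        have := zpow_le_zpow_right₀ (a := (2 : ℚ)) (by norm_num) hkK'
        rw [zpow_add_one₀ (by norm_num : (2 : ℚ) ≠ 0)] at this; linarith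
      have h1 : fl t - t ≤ unitRoundoff q * 2 ^ k := by
        have := (abs_le.mp herr).1; linarith
      calc fl t - t ≤ unitRoundoff q * 2 ^ k := h1
        _ ≤ unitRoundoff q * (2 ^ K / 2) := mul_le_mul_of_nonneg_left hpow' hu0
        _ = unitRoundoff q * 2 ^ K / 2 := by ring


end Summit.Ventures.CertifiedArithmetic.LowPrec.Opt
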